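import Summits.BirchSwinnertonDyer.BirchSwinnertonDyer.Theorems.EisensteinPrimesX2AnalyticMuOrbitSum
import Summits.BirchSwinnertonDyer.BirchSwinnertonDyer.Theorems.EisensteinPrimesX2AnalyticLambdaCertificate
import Summits.BirchSwinnertonDyer.BirchSwinnertonDyer.Theorems.EisensteinPrimesMazurMCOnCellBMuPartTightParity
import Summits.BirchSwinnertonDyer.Rank1Residual.X2.TamagawaSqueeze
import HarnessLib

/-!
# Crux `MazurMCOnCellB` (stmt-BirchSwinnertonDyer-19033), line `mudescent` v4: BOTH typed analytic inputs of the
# skeleton at an X2b pair — `X2.AnalyticMuLE W p 0` (stub 3′ via p611858) and `X2.AnalyticLambdaEq W p n` (the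
# value `n = λ_an` of stub 4″) — from ONE finite ORBIT TABLE of plus modular symbols, with NO side condition
# (helper; theorems only, no definition, no named fact)

Cell `bsd-eis`, D-0154 width seat `bsd-line-x2-p1-w2` (gen 3), μ-lineage; sequel of this seat's
`…X2OrbitSupNorm` (p614896: `sup_k ‖c_k‖ = sup_{n,s} ‖ν_n(s)‖` for the `ω⁰`-transform, no cell bound) and
`…X2AnalyticMuOrbitSum` (`X2.AnalyticMuLE` ⟺ a large Néron-normalised Teichmüller-orbit sum).

THE ORBIT TABLE at tower level `N` of a pair `(E, p)`, `p ‖ N_E` odd, newform `f`, period ratio `ϖ`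
(`ϖ·Ω_E = Ω⁺_f`): the `p^N` rationals `x_N(s) = ϖ·∑_{η^{p−1}=1} [η γˢ/p^{N+1}]⁺_f` (`γ = 1 + p`, `s mod p^N`;
each a sum of `p − 1` plus modular symbols at the cusps `ηγˢ/p^{N+1}`), and their binomial moments
`R_N(j) = ∑_s x_N(s)·(s choose j) ∈ ℚ` — up to the sign `a_p^{N+1}` the level-`N` Riemann sums of THE
Mazur–Tate–Teitelbaum function `ϖ·L_p(E,T)` (MTT §I.10 with `ε(p) = 0`, §I.13). This file proves:

* `norm_riemannSum_eq_norm_orbitMoment` — for the signed scaled distribution `ϖ·a_pⁿ·[a/pⁿ]⁺_f` the tree's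
  Riemann sum `RS(j,N)` has the norm of `R_N(j)`;
* **`analyticMuLE_zero_and_analyticLambdaEq_of_orbitTable`** — if `n < p^N`, `‖R_N(j)‖_p ≤ p⁻¹` for `j < n` and
  `‖R_N(n)‖_p = 1`, then `X2.AnalyticMuLE W p 0 ∧ X2.AnalyticLambdaEq W p n`. Mechanism: a unit moment forces a
  unit orbit sum, hence `μ_an = 0` by the isometry (`…X2AnalyticMuOrbitSum`); for the `λ`-clause the integral
  model `G` (`ι G = ϖ·L`) bounds the COEFFICIENTS by `1`, the isometry transfers the bound to the ORBIT SUMS,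
  the sharp congruence (`…X2OrbitSupNorm.norm_sub_riemannSum_le_of_forall_norm_orbit_le`) gives
  `‖[T^j](ϖ·L) − a_p^{N+1}R_N(j)‖ ≤ p⁻¹` below degree `p^N`, and lam-a's first-unit-coefficient producer
  (`…X2AnalyticLambdaCertificate.analyticMuLE_zero_and_analyticLambdaEq_of_firstUnitCoeff`, p≈5447xx) finishes.
  Compare the tree's coefficient certificates (`Iwasawa.UnitCoeffAt`, `…RiemannSumCongruenceCertificateProofs`),
  which need a CELL bound `C ≤ 1` = `p`-integral Néron-normalised symbols — false in general at an X2b étale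
  end carrying `p`-torsion; here NO integrality, special-value, Manin-constant or image hypothesis enters.
* `analyticMuLE_zero_and_analyticLambdaEq_of_orbitTable_display` — the same with the table DISPLAYED as a
  function `x : ZMod (p^N) → ℚ` plus the identification hypothesis, the shape of a census record.

HONEST FRAMING: per-pair instrumentation for stubs 3′/4″ (the VALUE `λ_an` and `μ_an = 0` at a pair from one
finite symbol table, kernel arithmetic deciding); nothing class-wide; nothing about any curve is asserted;
closes no stub; beyond-print theorem: no (MTT §I.10–I.13 + Washington §7.1 folklore made kernel).

References: [MazurTateTeitelbaum1986Invent] §I.10, §I.12–I.13; [GreenbergVatsal2000] (1)–(3); [Washington1997] §7.1.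
-/

set_option autoImplicit false
noncomputable section
open Filter Topology
open scoped Classical MatrixGroups ModularForm
open CongruenceSubgroup WeierstrassCurve Literature.NumberTheory.EllipticCurves
  Literature.NumberTheory.EllipticCurves.ModularForms
  Literature.NumberTheory.EllipticCurves.Rank1Residual
  Summit.BirchSwinnertonDyer.Rank1Residual
  Summit.BirchSwinnertonDyer.BirchSwinnertonDyer.Theorems.EisensteinPrimesX2OrbitSupNorm
  Summit.BirchSwinnertonDyer.BirchSwinnertonDyer.Theorems.EisensteinPrimesX2AnalyticMuOrbitSum

set_option linter.dupNamespace false -- summit and sub-problem share a name (D-0017 layout)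
namespace Summit.BirchSwinnertonDyer.BirchSwinnertonDyer.Theorems.EisensteinPrimesX2AnalyticOrbitTable
variable {p : ℕ} [Fact p.Prime]

/-! ## §1. The Riemann sums of the signed scaled distribution are the orbit moments -/

section Moments

variable {N₀ : ℕ} {f : CuspForm (Gamma0 N₀) 2}

/-- **`‖RS(j,N)‖ = ‖R_N(j)‖`**: for the distribution `a ↦ ϖ·εⁿ·[a/pⁿ]⁺_f` (`‖ε‖ = 1`, `p` odd) the tree's
Riemann sum `∑_η ∑_s ϖ ε^{N+e₀}[η̄γˢ/p^{N+e₀}]⁺_f (s choose j)` has the norm of the orbit moment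
`∑_s ϖ·T_{N+e₀}(γˢ)·(s choose j)`, `T_m(a) = ∑_{η^{p−1}=1}[ηa/p^m]⁺_f = teichOrbitSum f p m a`.
[cite: MazurTateTeitelbaum1986Invent, §I.10 (10.1) and §I.13] -/
theorem norm_riemannSum_eq_norm_orbitMoment (hp2 : p ≠ 2) (ϖ : ℚ) {ε : ℚ_[p]} (hε : ‖ε‖ = 1)
    (j N : ℕ) :
    ‖∑ᶠ ξ : rootsOfUnity (torsionOrder p) ℤ_[p], ∑ s : ZMod (p ^ N),
        ((ϖ : ℚ) : ℚ_[p]) * (ε ^ (N + cyclotomicExponent p) *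
          (ratPlusSymbol f
            (((PadicInt.toZModPow (N + cyclotomicExponent p) ((ξ : ℤ_[p]ˣ) : ℤ_[p]) *
                (cyclotomicGenerator p : ZMod (p ^ (N + cyclotomicExponent p))) ^ s.val).val : ℚ) /
              (p : ℚ) ^ (N + cyclotomicExponent p)) : ℚ_[p])) *
          ((s.val.choose j : ℕ) : ℚ_[p])‖ =
      ‖((∑ s : ZMod (p ^ N), ϖ * teichOrbitSum f p (N + cyclotomicExponent p)
          ((cyclotomicGenerator p : ZMod (p ^ (N + cyclotomicExponent p))) ^ s.val) *
            (s.val.choose j : ℚ) : ℚ) : ℚ_[p])‖ := by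
  classical
  haveI := neZero_torsionOrder p
  haveI := Fintype.ofFinite (rootsOfUnity (torsionOrder p) ℤ_[p])
  have hm : 1 ≤ N + cyclotomicExponent p :=
    le_add_of_le_right (Nat.pos_of_ne_zero (cyclotomicExponent_ne_zero p))
  -- regroup the Riemann sum as `ε^{N+e₀} · (cast of the orbit moment)`
  have key : (∑ᶠ ξ : rootsOfUnity (torsionOrder p) ℤ_[p], ∑ s : ZMod (p ^ N),
        ((ϖ : ℚ) : ℚ_[p]) * (ε ^ (N + cyclotomicExponent p) *
          (ratPlusSymbol f
            (((PadicInt.toZModPow (N + cyclotomicExponent p) ((ξ : ℤ_[p]ˣ) : ℤ_[p]) *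
                (cyclotomicGenerator p : ZMod (p ^ (N + cyclotomicExponent p))) ^ s.val).val : ℚ) /
              (p : ℚ) ^ (N + cyclotomicExponent p)) : ℚ_[p])) *
          ((s.val.choose j : ℕ) : ℚ_[p])) =
      ε ^ (N + cyclotomicExponent p) *
        ((∑ s : ZMod (p ^ N), ϖ * teichOrbitSum f p (N + cyclotomicExponent p)
          ((cyclotomicGenerator p : ZMod (p ^ (N + cyclotomicExponent p))) ^ s.val) *
            (s.val.choose j : ℚ) : ℚ) : ℚ_[p]) := by
    rw [finsum_eq_sum_of_fintype, Finset.sum_comm, Rat.cast_sum, Finset.mul_sum]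
    refine Finset.sum_congr rfl fun s _ ↦ ?_
    rw [Rat.cast_mul, Rat.cast_mul, Rat.cast_natCast, teichOrbitSum_eq_finsum f hp2 hm,
      finsum_eq_sum_of_fintype, Rat.cast_sum]
    simp only [Finset.mul_sum, Finset.sum_mul]
    refine Finset.sum_congr rfl fun ξ _ ↦ ?_
    ring
  rw [key, norm_mul, norm_pow, hε, one_pow, one_mul]

end Moments

/-! ## §2. The orbit table ⟹ `μ_an = 0` and the VALUE of `λ_an` -/

section OrbitTable

variable {W : WeierstrassCurve ℚ} [W.IsElliptic] [W.IsGloballyMinimal]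
  {N₀ : ℕ} [NeZero N₀] {f : CuspForm (Gamma0 N₀) 2} {ϖ : ℚ}

/-- **THE ORBIT-TABLE DOOR FOR BOTH ANALYTIC INPUTS.** Let `p` be an odd multiplicative prime of `W/ℚ`, `f` a
newform of `W`, `ϖ·Ω_W = Ω⁺_f`, and `N` a level with `n < p^N`. Suppose the orbit moments
`R_N(j) = ∑_{s mod p^N} ϖ·T_{N+1}(γˢ)·(s choose j)` (`T_{N+1}(a) = ∑_{η^{p−1}=1}[ηa/p^{N+1}]⁺_f`, `γ = 1+p`)
satisfy `‖R_N(j)‖_p ≤ p⁻¹` for `j < n` and `‖R_N(n)‖_p = 1`. Then `X2.AnalyticMuLE W p 0` and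
`X2.AnalyticLambdaEq W p n` (`λ_an(W,p) = n`, trivial zero included). NO integrality, special-value,
Manin-constant or image hypothesis: the bound `1` on the orbit sums needed by the congruence comes, inside the
`λ`-clause, from the integral model `G` through the isometry of `…X2OrbitSupNorm`.
[cite: MazurTateTeitelbaum1986Invent, §I.10 (ε(p) = 0, α = a_p) and §I.12–I.13] [cite: GreenbergVatsal2000, p. 2–3, (1)–(2)]
[cite: Washington1997, §7.1 (Prop. 7.2, Thm. 7.3)] -/
theorem analyticMuLE_zero_and_analyticLambdaEq_of_orbitTable (hp2 : p ≠ 2)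
    (hmult : W.HasMultiplicativeReductionAtPrime p) (hf : IsNewformOf W f)
    (hϖ : (ϖ : ℝ) * W.realPeriodRat = plusPeriod f) {n N : ℕ} (hnN : n < p ^ N)
    (hlow : ∀ j < n, ‖((∑ s : ZMod (p ^ N), ϖ * teichOrbitSum f p (N + 1)
        ((cyclotomicGenerator p : ZMod (p ^ (N + 1))) ^ s.val) * (s.val.choose j : ℚ) : ℚ) : ℚ_[p])‖ ≤
          (p : ℝ)⁻¹)
    (hn : ‖((∑ s : ZMod (p ^ N), ϖ * teichOrbitSum f p (N + 1)
        ((cyclotomicGenerator p : ZMod (p ^ (N + 1))) ^ s.val) * (s.val.choose n : ℚ) : ℚ) : ℚ_[p])‖ = 1) :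
    X2.AnalyticMuLE W p 0 ∧ X2.AnalyticLambdaEq W p n := by
  classical
  haveI := neZero_torsionOrder p
  haveI := Fintype.ofFinite (rootsOfUnity (torsionOrder p) ℤ_[p])
  haveI : NeZero (p ^ N) := ⟨pow_ne_zero _ (Fact.out : p.Prime).ne_zero⟩
  have hp1 : (1 : ℝ) < p := by exact_mod_cast (Fact.out : p.Prime).one_lt
  have hpinv : (p : ℝ)⁻¹ < 1 := inv_lt_one_of_one_lt₀ hp1
  have he : cyclotomicExponent p = 1 := if_neg hp2
  -- the hypotheses at type level `N + e₀`
  have hlow' : ∀ j < n, ‖((∑ s : ZMod (p ^ N), ϖ * teichOrbitSum f p (N + cyclotomicExponent p)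
      ((cyclotomicGenerator p : ZMod (p ^ (N + cyclotomicExponent p))) ^ s.val) *
        (s.val.choose j : ℚ) : ℚ) : ℚ_[p])‖ ≤ (p : ℝ)⁻¹ := by rw [he]; exact hlow
  have hn' : ‖((∑ s : ZMod (p ^ N), ϖ * teichOrbitSum f p (N + cyclotomicExponent p)
      ((cyclotomicGenerator p : ZMod (p ^ (N + cyclotomicExponent p))) ^ s.val) *
        (s.val.choose n : ℚ) : ℚ) : ℚ_[p])‖ = 1 := by rw [he]; exact hn
  -- THE function (either sign) and its Riemann sums
  have hQ : coeffField f = ⊥ := hf.coeffField_eq_bot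
  have hrat : ∀ r : ℚ, (ratPlusSymbol f r : ℝ) = normalizedPlusSymbol f r :=
    ratCast_ratPlusSymbol_holds hf.1 hQ
  obtain ⟨ε, L, hε, hLs, hLn, hdist, hlim⟩ : ∃ (ε : ℚ_[p]) (L : PowerSeries ℚ_[p]), ‖ε‖ = 1 ∧
      (W.HasSplitMultiplicativeReductionAtPrime p → IsSplitMultPAdicLFunctionOf f p L) ∧
      (¬ W.HasSplitMultiplicativeReductionAtPrime p → IsMultPAdicLFunctionOf f p (-1) L) ∧
      (∀ (m : ℕ) (a : ZMod (p ^ m)),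
        ∑ b ∈ Finset.univ.filter (fun b : ZMod (p ^ (m + 1)) ↦
          ZMod.castHom (pow_dvd_pow p m.le_succ) (ZMod (p ^ m)) b = a),
            ε ^ (m + 1) * (ratPlusSymbol f ((b.val : ℚ) / (p : ℚ) ^ (m + 1)) : ℚ_[p]) =
          ε ^ m * (ratPlusSymbol f ((a.val : ℚ) / (p : ℚ) ^ m) : ℚ_[p])) ∧
      (∀ k : ℕ, Tendsto (fun m : ℕ ↦
        ∑ᶠ u : rootsOfUnity (torsionOrder p) ℤ_[p], ∑ s : ZMod (p ^ m),
          (ε ^ (m + cyclotomicExponent p) *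
            (ratPlusSymbol f
              (((PadicInt.toZModPow (m + cyclotomicExponent p) ((u : ℤ_[p]ˣ) : ℤ_[p]) *
                  (cyclotomicGenerator p : ZMod (p ^ (m + cyclotomicExponent p))) ^ s.val).val : ℚ) /
                (p : ℚ) ^ (m + cyclotomicExponent p)) : ℚ_[p])) *
            ((s.val.choose k : ℕ) : ℚ_[p])) atTop (𝓝 (PowerSeries.coeff k L))) := by
    by_cases hs : W.HasSplitMultiplicativeReductionAtPrime p
    · obtain ⟨L, hL⟩ := exists_isSplitMultPAdicLFunctionOf hs hf
      have hap : cuspCoeff f p = 1 := (hf.cuspCoeff_eq_one_and_sq_of_split hs).1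
      have hpN : p ∣ N₀ := hf.dvd_level_of_split hs
      have hfib := sum_fiber_ratPlusSymbol_eq hrat hf.1 hpN hap
      refine ⟨1, L, norm_one, fun _ ↦ hL, fun hns ↦ absurd hs hns, fun m a ↦ ?_, fun k ↦ ?_⟩
      · simp only [one_pow, one_mul]
        exact hfib m a
      · refine (hL.tendsto_riemannSum_coeff hs hf k).congr fun m ↦ ?_
        simp only [one_pow, one_mul]
    · obtain ⟨L, hL⟩ := exists_isMultPAdicLFunctionOf_neg_one_of_nonsplit hf hmult hs
      obtain ⟨hap, hpN⟩ := hf.cuspCoeff_eq_neg_one_and_dvd_of_nonsplit hmult hs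
      have hfib := sum_fiber_ratPlusSymbol_eq_neg hrat hf.1 hpN hap
      refine ⟨-1, L, by rw [norm_neg, norm_one], fun hs' ↦ absurd hs' hs, fun _ ↦ hL, fun m a ↦ ?_,
        fun k ↦ hL.tendsto_riemannSum_coeff_of_nonsplit hf hmult hs k⟩
      rw [← Finset.mul_sum, hfib m a]
      ring
  -- the signed scaled distribution, its Riemann and orbit sums
  set μ : (m : ℕ) → ZMod (p ^ m) → ℚ_[p] := fun m a ↦
    ((ϖ : ℚ) : ℚ_[p]) * (ε ^ m * (ratPlusSymbol f ((a.val : ℚ) / (p : ℚ) ^ m) : ℚ_[p])) with hμ_def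
  set RS : ℕ → ℕ → ℚ_[p] := fun k m ↦
    ∑ᶠ ξ : rootsOfUnity (torsionOrder p) ℤ_[p], ∑ s : ZMod (p ^ m),
      μ (m + cyclotomicExponent p)
          (PadicInt.toZModPow (m + cyclotomicExponent p) ((ξ : ℤ_[p]ˣ) : ℤ_[p]) *
            (cyclotomicGenerator p : ZMod (p ^ (m + cyclotomicExponent p))) ^ s.val) *
        ((s.val.choose k : ℕ) : ℚ_[p]) with hRS_def
  set ν : (m : ℕ) → ZMod (p ^ m) → ℚ_[p] := fun m s ↦
    ∑ᶠ ξ : rootsOfUnity (torsionOrder p) ℤ_[p],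
      μ (m + cyclotomicExponent p)
        (PadicInt.toZModPow (m + cyclotomicExponent p) ((ξ : ℤ_[p]ˣ) : ℤ_[p]) *
          (cyclotomicGenerator p : ZMod (p ^ (m + cyclotomicExponent p))) ^ s.val) with hν_def
  have hRS : ∀ k m : ℕ, RS k m =
      ∑ᶠ ξ : rootsOfUnity (torsionOrder p) ℤ_[p], ∑ s : ZMod (p ^ m),
        μ (m + cyclotomicExponent p)
            (PadicInt.toZModPow (m + cyclotomicExponent p) ((ξ : ℤ_[p]ˣ) : ℤ_[p]) *
              (cyclotomicGenerator p : ZMod (p ^ (m + cyclotomicExponent p))) ^ s.val) *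
          ((s.val.choose k : ℕ) : ℚ_[p]) := fun _ _ ↦ rfl
  have hν : ∀ (m : ℕ) (s : ZMod (p ^ m)), ν m s =
      ∑ᶠ ξ : rootsOfUnity (torsionOrder p) ℤ_[p],
        μ (m + cyclotomicExponent p)
          (PadicInt.toZModPow (m + cyclotomicExponent p) ((ξ : ℤ_[p]ˣ) : ℤ_[p]) *
            (cyclotomicGenerator p : ZMod (p ^ (m + cyclotomicExponent p))) ^ s.val) := fun _ _ ↦ rfl
  have hdist' : ∀ (m : ℕ) (a : ZMod (p ^ m)),
      ∑ b ∈ Finset.univ.filter (fun b : ZMod (p ^ (m + 1)) ↦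
        ZMod.castHom (pow_dvd_pow p m.le_succ) (ZMod (p ^ m)) b = a), μ (m + 1) b = μ m a := by
    intro m a
    simp only [hμ_def]
    rw [← Finset.mul_sum, hdist m a]
  obtain ⟨C, hC0⟩ := exists_norm_ratPlusSymbol_le (p := p) hf.1 hQ
  have hC : ∀ (m : ℕ) (a : ZMod (p ^ m)), ‖μ m a‖ ≤ ‖((ϖ : ℚ) : ℚ_[p])‖ * C := by
    intro m a
    simp only [hμ_def]
    rw [norm_mul, norm_mul, norm_pow, hε, one_pow, one_mul]
    exact mul_le_mul_of_nonneg_left (hC0 m a) (norm_nonneg _)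
  have hV := norm_orbit_le_of_forall_norm_le hν hC
  have hc : ∀ k : ℕ, Tendsto (fun m ↦ RS k m) atTop
      (𝓝 (PowerSeries.coeff k (PowerSeries.C ((ϖ : ℚ) : ℚ_[p]) * L))) := by
    intro k
    have h := (hlim k).const_mul ((ϖ : ℚ) : ℚ_[p])
    rw [← PowerSeries.coeff_C_mul] at h
    refine h.congr fun m ↦ ?_
    simp only [hRS_def, hμ_def, finsum_eq_sum_of_fintype, Finset.mul_sum, mul_assoc]
  -- the Riemann sums at level `N` have the norms of the orbit moments
  have hRSnorm : ∀ j : ℕ, ‖RS j N‖ = ‖((∑ s : ZMod (p ^ N), ϖ *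
      teichOrbitSum f p (N + cyclotomicExponent p)
        ((cyclotomicGenerator p : ZMod (p ^ (N + cyclotomicExponent p))) ^ s.val) *
          (s.val.choose j : ℚ) : ℚ) : ℚ_[p])‖ := fun j ↦ by
    simp only [hRS_def, hμ_def]
    exact norm_riemannSum_eq_norm_orbitMoment hp2 ϖ hε j N
  -- μ_an = 0: the unit moment forces a unit orbit sum, hence a unit coefficient (isometry)
  have hunitν : ∃ s : ZMod (p ^ N), (p : ℝ)⁻¹ < ‖ν N s‖ := by
    by_contra hcon
    push Not at hcon
    have h := norm_riemannSum_le_of_forall_norm_orbit_le hRS hν (by positivity) hcon n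
    rw [hRSnorm n, hn'] at h
    exact absurd h (not_le.mpr hpinv)
  have hμ0 : X2.AnalyticMuLE W p 0 := by
    refine (EisensteinPrimesX2AnalyticLambdaCertificate.analyticMuLE_iff_of_datum hf hϖ hLs hLn 0).mpr ?_
    obtain ⟨s, hs⟩ := hunitν
    obtain ⟨k, hk⟩ := (exists_lt_norm_lim_iff_exists_lt_norm_orbit hRS hν hdist' hV hc
      (by positivity : (0 : ℝ) ≤ (p : ℝ)⁻¹)).mpr ⟨N, s, hs⟩
    refine ⟨k, ?_⟩
    have : (p : ℝ) ^ (-(((0 : ℕ) : ℤ) + 1)) = (p : ℝ)⁻¹ := by simp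
    rwa [this]
  refine ⟨hμ0, (EisensteinPrimesX2AnalyticLambdaCertificate.analyticLambdaEq_iff_of_datum hf hϖ hLs hLn n).mpr
    fun G hG ↦ ?_⟩
  -- λ_an = n: `G` bounds the coefficients by 1, the isometry bounds the orbit sums by 1, and the sharp
  -- congruence reads the first unit coefficient off the table
  have hcoe1 : ∀ k : ℕ, ‖PowerSeries.coeff k (PowerSeries.C ((ϖ : ℚ) : ℚ_[p]) * L)‖ ≤ 1 := fun k ↦ by
    rw [← EisensteinPrimesX2AnalyticLambdaCertificate.norm_coeff_eq_of_iota_eq hG k]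
    exact PadicInt.norm_le_one _
  have hν1 : ∀ (m : ℕ) (s : ZMod (p ^ m)), ‖ν m s‖ ≤ 1 :=
    norm_orbit_le_of_forall_norm_lim_le hRS hν hdist' hV hc zero_le_one hcoe1
  have hcong : ∀ j < p ^ N, ‖PowerSeries.coeff j (PowerSeries.C ((ϖ : ℚ) : ℚ_[p]) * L) - RS j N‖ ≤
      (p : ℝ)⁻¹ := fun j hj ↦ by
    have h := norm_sub_riemannSum_le_of_forall_norm_orbit_le hRS hν hdist' zero_le_one hν1 hj (hc j)
    rwa [one_mul] at h
  have hlowc : ∀ j < n, ‖PowerSeries.coeff j (PowerSeries.C ((ϖ : ℚ) : ℚ_[p]) * L)‖ < 1 := by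
    intro j hj
    have h1 := hcong j (hj.trans hnN)
    have h2 : ‖RS j N‖ ≤ (p : ℝ)⁻¹ := by rw [hRSnorm j]; exact hlow' j hj
    have h3 : PowerSeries.coeff j (PowerSeries.C ((ϖ : ℚ) : ℚ_[p]) * L) =
        (PowerSeries.coeff j (PowerSeries.C ((ϖ : ℚ) : ℚ_[p]) * L) - RS j N) + RS j N := by ring
    rw [h3]
    exact ((IsUltrametricDist.norm_add_le_max _ _).trans (max_le h1 h2)).trans_lt hpinv
  have hnc : ‖PowerSeries.coeff n (PowerSeries.C ((ϖ : ℚ) : ℚ_[p]) * L)‖ = 1 := by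
    have h1 := hcong n hnN
    have h2 : ‖RS n N‖ = 1 := by rw [hRSnorm n]; exact hn'
    have h3 : PowerSeries.coeff n (PowerSeries.C ((ϖ : ℚ) : ℚ_[p]) * L) =
        RS n N + (PowerSeries.coeff n (PowerSeries.C ((ϖ : ℚ) : ℚ_[p]) * L) - RS n N) := by ring
    rw [h3]
    have hlt : ‖PowerSeries.coeff n (PowerSeries.C ((ϖ : ℚ) : ℚ_[p]) * L) - RS n N‖ < ‖RS n N‖ := by
      rw [h2]; exact h1.trans_lt hpinv
    rw [IsUltrametricDist.norm_add_eq_max_of_norm_ne_norm hlt.ne', max_eq_left hlt.le, h2]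
  exact (EisensteinPrimesX2AnalyticLambdaCertificate.analyticMuLE_zero_and_analyticLambdaEq_of_firstUnitCoeff
    hf hϖ hLs hLn hlowc hnc).2 f hf ϖ hϖ L hLs hLn G hG

/-- **Census-record shape**: the orbit table DISPLAYED as `x : ℤ/p^N → ℚ` with the identification
`x s = ϖ·T_{N+1}(γˢ)` for every newform `f` of `W` and its `ϖ` (the `p^N` exact rationals of a record), and the
two KERNEL-arithmetic facts `‖∑_s x(s)(s choose j)‖_p ≤ p⁻¹` (`j < n`), `‖∑_s x(s)(s choose n)‖_p = 1`, `n < p^N`,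
give `X2.AnalyticMuLE W p 0 ∧ X2.AnalyticLambdaEq W p n` at an odd multiplicative `p`, granted modularity
(`hpar`, to produce a newform). [cite: MazurTateTeitelbaum1986Invent, §I.10 and §I.12–I.13]
[cite: GreenbergVatsal2000, p. 2–3, (1)–(2)] -/
theorem analyticMuLE_zero_and_analyticLambdaEq_of_orbitTable_display
    (hpar : nonempty_modularParametrizationData) (hp2 : p ≠ 2)
    (hmult : W.HasMultiplicativeReductionAtPrime p) {n N : ℕ} (hnN : n < p ^ N) (x : ZMod (p ^ N) → ℚ)
    (hx : ∀ {M : ℕ} [NeZero M] (g : CuspForm (Gamma0 M) 2), IsNewformOf W g →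
      ∀ (ϖ : ℚ), (ϖ : ℝ) * W.realPeriodRat = plusPeriod g → ∀ s : ZMod (p ^ N),
        ϖ * teichOrbitSum g p (N + 1) ((cyclotomicGenerator p : ZMod (p ^ (N + 1))) ^ s.val) = x s)
    (hlow : ∀ j < n, ‖((∑ s : ZMod (p ^ N), x s * (s.val.choose j : ℚ) : ℚ) : ℚ_[p])‖ ≤ (p : ℝ)⁻¹)
    (hn : ‖((∑ s : ZMod (p ^ N), x s * (s.val.choose n : ℚ) : ℚ) : ℚ_[p])‖ = 1) :
    X2.AnalyticMuLE W p 0 ∧ X2.AnalyticLambdaEq W p n := by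
  haveI : NeZero (W.conductorNorm ℤ) := ⟨(W.conductorNorm_pos_holds).ne'⟩
  obtain ⟨D⟩ := hpar W
  obtain ⟨ϖ, -, hϖ, -⟩ := D.exists_rat_mul_realPeriodRat_eq_plusPeriod
  have hxs := hx D.f D.isNewformOf ϖ hϖ
  refine analyticMuLE_zero_and_analyticLambdaEq_of_orbitTable hp2 hmult D.isNewformOf hϖ hnN
    (fun j hj ↦ ?_) ?_
  · have h : (∑ s : ZMod (p ^ N), ϖ * teichOrbitSum D.f p (N + 1)
        ((cyclotomicGenerator p : ZMod (p ^ (N + 1))) ^ s.val) * (s.val.choose j : ℚ)) =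
        ∑ s : ZMod (p ^ N), x s * (s.val.choose j : ℚ) :=
      Finset.sum_congr rfl fun s _ ↦ by rw [hxs s]
    rw [h]; exact hlow j hj
  · have h : (∑ s : ZMod (p ^ N), ϖ * teichOrbitSum D.f p (N + 1)
        ((cyclotomicGenerator p : ZMod (p ^ (N + 1))) ^ s.val) * (s.val.choose n : ℚ)) =
        ∑ s : ZMod (p ^ N), x s * (s.val.choose n : ℚ) :=
      Finset.sum_congr rfl fun s _ ↦ by rw [hxs s]
    rw [h]; exact hn

end OrbitTable

/-! ## §3. END-TO-END at a pair: orbit table + algebraic λ-bound ⟹ Mazur's main conjecture at `(W, p)`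
(appended by the same seat; the v4 skeleton's per-pair shape with BOTH analytic stubs read off one symbol table) -/

section EndToEnd

variable {W : WeierstrassCurve ℚ} [W.IsElliptic] [W.IsGloballyMinimal]
  {N₀ : ℕ} [NeZero N₀] {f : CuspForm (Gamma0 N₀) 2} {ϖ : ℚ}

/-- **END-TO-END, EXACT SLACK (route T).** At an odd multiplicative prime with `E[p]` reducible: the orbit table
(`‖R_N(j)‖_p ≤ p⁻¹` for `j < n`, `‖R_N(n)‖_p = 1`, `n < p^N`) plus an algebraic bound `λ(X(E/ℚ_∞)) ≥ k` for every
cyclotomic torsion dual datum (`AlgebraicLambdaGE`, e.g. the tower budget on census Tamagawa rows) with `n ≤ k`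
(non-split) / `n ≤ k + 1` (split: the trivial zero) give Mazur's main conjecture AT THE PAIR, modulo Wuthrich 2014
Thm. 16 (`hWu`) — the tree's route T `X2.mazurMainConjectureAt_of_algebraicLambdaGE` fed by §2. (lam-a's
`mazurMainConjectureAt_of_unitCoeffAt_of_algebraicLambdaGE` is the same door in unit-coefficient currency.)
[cite: Wuthrich2014, Thm. 16 (p. 397)] [cite: GreenbergLNM1716, Cor. 5.6 (proof, p. 136) and §5 p. 183]
[cite: MazurTateTeitelbaum1986Invent, §I.10 and §I.12–I.13] -/
theorem mazurMainConjectureAt_of_orbitTable_of_algebraicLambdaGE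
    (hWu : Wuthrich2014.thm16_charIdeal_dvd_multiplicative_of_reducible) (hp2 : p ≠ 2)
    (hmult : W.HasMultiplicativeReductionAtPrime p) (hred : ¬ W.HasIrreducibleModPGaloisRep p)
    (hf : IsNewformOf W f) (hϖ : (ϖ : ℝ) * W.realPeriodRat = plusPeriod f) {n N k : ℕ} (hnN : n < p ^ N)
    (hlow : ∀ j < n, ‖((∑ s : ZMod (p ^ N), ϖ * teichOrbitSum f p (N + 1)
        ((cyclotomicGenerator p : ZMod (p ^ (N + 1))) ^ s.val) * (s.val.choose j : ℚ) : ℚ) : ℚ_[p])‖ ≤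
          (p : ℝ)⁻¹)
    (hn : ‖((∑ s : ZMod (p ^ N), ϖ * teichOrbitSum f p (N + 1)
        ((cyclotomicGenerator p : ZMod (p ^ (N + 1))) ^ s.val) * (s.val.choose n : ℚ) : ℚ) : ℚ_[p])‖ = 1)
    (halg : X1.TamagawaSqueeze.AlgebraicLambdaGE W p k)
    (hkN : ¬ W.HasSplitMultiplicativeReductionAtPrime p → n ≤ k)
    (hkS : W.HasSplitMultiplicativeReductionAtPrime p → n ≤ k + 1) :
    X2.MazurMainConjectureAt W p := by
  obtain ⟨hμ0, hlam⟩ := analyticMuLE_zero_and_analyticLambdaEq_of_orbitTable hp2 hmult hf hϖ hnN hlow hn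
  exact X2.mazurMainConjectureAt_of_algebraicLambdaGE hWu W p hp2 hmult hred hμ0 hlam halg hkN hkS

/-- **END-TO-END, PARITY SLACK (the v4 skeleton AT A PAIR).** Same table and algebraic bound, with the WEAK comparison of
stub 4″ (`n ≤ k + 1` non-split / `n ≤ k + 2` split) in analytic rank `≤ 1`: the parity `λ_an ≡ r_an + e` is a kernel theorem
for the typed datum (`X2.analyticLambdaEq_parity`, fed here by the table's own `μ`-certificate — no Greenberg–Stevens /
non-vanishing input), and the μ-TOLERANT PARITY route T (`…MuPartTightParity.mazurMainConjectureAt_of_muPart_of_lambdaCountParity`,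
p611137) closes, modulo Wuthrich Thm. 16 (`hWu`), modularity (`hpar`), Greenberg 1999 Prop. 3.10 (`h310`) and GZK (`hGZK`) —
exactly the named inputs of `MazurMCOnCellB_of` (v4) at the located pair. Honest framing: per pair; closes no stub.
[cite: GreenbergLNM1716, Prop. 3.10 (p. 82), Cor. 5.6 (p. 136)] [cite: Wuthrich2014, Thm. 16 (p. 397)]
[cite: MazurTateTeitelbaum1986Invent, §I.10, §I.12–I.13 and §I.17] -/
theorem mazurMainConjectureAt_of_orbitTable_of_algebraicLambdaGE_weak
    (hWu : Wuthrich2014.thm16_charIdeal_dvd_multiplicative_of_reducible)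
    (hpar : nonempty_modularParametrizationData)
    (h310 : Greenberg1999.prop310_selmerCorank_mod_two_eq_lambdaInvariant)
    (hGZK : rank_eq_analyticRank_of_analyticRank_le_one) (hp2 : p ≠ 2)
    (hmult : W.HasMultiplicativeReductionAtPrime p) (hred : ¬ W.HasIrreducibleModPGaloisRep p)
    (hr : W.analyticRank ≤ 1)
    (hf : IsNewformOf W f) (hϖ : (ϖ : ℝ) * W.realPeriodRat = plusPeriod f) {n N k : ℕ} (hnN : n < p ^ N)
    (hlow : ∀ j < n, ‖((∑ s : ZMod (p ^ N), ϖ * teichOrbitSum f p (N + 1)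
        ((cyclotomicGenerator p : ZMod (p ^ (N + 1))) ^ s.val) * (s.val.choose j : ℚ) : ℚ) : ℚ_[p])‖ ≤
          (p : ℝ)⁻¹)
    (hn : ‖((∑ s : ZMod (p ^ N), ϖ * teichOrbitSum f p (N + 1)
        ((cyclotomicGenerator p : ZMod (p ^ (N + 1))) ^ s.val) * (s.val.choose n : ℚ) : ℚ) : ℚ_[p])‖ = 1)
    (halg : X1.TamagawaSqueeze.AlgebraicLambdaGE W p k)
    (hkN : ¬ W.HasSplitMultiplicativeReductionAtPrime p → n ≤ k + 1)
    (hkS : W.HasSplitMultiplicativeReductionAtPrime p → n ≤ k + 2) :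
    X2.MazurMainConjectureAt W p := by
  obtain ⟨hμ0, hlam⟩ := analyticMuLE_zero_and_analyticLambdaEq_of_orbitTable hp2 hmult hf hϖ hnN hlow hn
  obtain ⟨hevN, hoddS⟩ := X2.analyticLambdaEq_parity hWu hpar W p hp2 hmult hred hμ0 hlam
  exact EisensteinPrimesMazurMCOnCellBMuPartTightParity.mazurMainConjectureAt_of_muPart_of_lambdaCountParity
    hWu h310 hGZK W p hp2 hmult hred hr ⟨0, hμ0⟩
    (EisensteinPrimesMazurMCOnCellBMuPartTight.muPart_of_analyticMuLE_zero hμ0) hlam halg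
    (fun hns ↦ ⟨hkN hns, hevN hns⟩) (fun hs ↦ ⟨hkS hs, hoddS hs⟩)

end EndToEnd

end Summit.BirchSwinnertonDyer.BirchSwinnertonDyer.Theorems.EisensteinPrimesX2AnalyticOrbitTable

end
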